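import Mathlib
import Literature.Computability.AlgebraicComplexity.SchoenhageTau

/-!
# Ideator1Sketch (route-free copy of Sketch.lean) — crux-ideate stmt-MatrixMultiplication-9876 (SmithPhaseGap), ideator 1, round 1

First lemmas of the two idea cards, stated over existing declarations (Mathlib + the route file).
Pauli matrices are inlined exactly as in the route's support item `OrbitBound`
(`P x z u v = if u = v + x then exp(2πi⟨z,v⟩/p) else 0` on `ℂ^((ℤ/p)^k)`).

* `PauliBasis`      — the `n²` Pauli matrices are linearly independent (nice error basis), the
                       algebraic core of "V|_E is the regular representation, every E-weight space
                       of V = A⊗B⊗C is a line, so (P V)^E = the p^{6k} Pauli twists of M are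
                       ISOLATED fixed points" (card parity-secant-resolution, localisation step).
* `PauliIrreducible` — the Heisenberg p-torus has no invariant subspace of `ℂ^n` other than `0`
                       and everything (non-torality: E fixes no partial flag, so E acts without
                       fixed points on every G_M^0/P, P a proper parabolic; card
                       flag-index-sandwich, Borel-entry step).
* `IndexSandwichShadow` — the numerical shadow of the sandwich that Lean can state today: if
                       bR(⟨p^k,p^k,p^k⟩) ≤ r then r is at least p^{2k} (the part of the sandwich
                       certified by single-letter = flattening-type index classes); stated only to
                       pin the quantifier shape of the line's target `TripartiteIndex r → r < bR`.
-/

namespace Summit.MatrixMultiplication.MatrixMultiplication.Cruxes.SmithPhaseGap.Ideator1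

open scoped BigOperators Matrix

/-- Defining equation of the Pauli–Heisenberg matrices on `ℂ^((ℤ/p)^k)`, as in `OrbitBound`. -/
def IsPauliFamily (p k : ℕ)
    (P : (Fin k → ZMod p) → (Fin k → ZMod p) →
      Matrix (Fin k → ZMod p) (Fin k → ZMod p) ℂ) : Prop :=
  ∀ x z u v, P x z u v =
    if u = v + x then Complex.exp (2 * Real.pi * Complex.I * ((∑ i, z i * v i).val : ℂ) / (p : ℂ))
    else 0

/-- FIRST LEMMA (card parity-secant-resolution): the Pauli matrices form a linearly independent
family of size `n² = dim Mat_n` (hence a basis; `tr(P_{x,z}^* P_{x',z'}) = n·δ`), so every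
character of the Heisenberg p-torus occurs in `Mat_n`, and in `V = Mat_n^{⊗3}`, exactly once.
Provable now (M-sized). -/
def PauliBasis : Prop :=
  ∀ (p k : ℕ) [Fact p.Prime]
    (P : (Fin k → ZMod p) → (Fin k → ZMod p) → Matrix (Fin k → ZMod p) (Fin k → ZMod p) ℂ),
    IsPauliFamily p k P →
      LinearIndependent ℂ (fun xz : (Fin k → ZMod p) × (Fin k → ZMod p) => P xz.1 xz.2)

/-- FIRST LEMMA (card flag-index-sandwich): the Heisenberg p-torus `F_p^{2k}` fixes no proper
non-zero subspace of `ℂ^{p^k}` (the Pauli representation is irreducible), hence fixes no partial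
flag: it lies in no proper parabolic of `PGL_n`, and acts fixed-point-freely on every flag variety
`GL_n/P`, `P` proper. Provable now (M-sized: the commutant of an invariant subspace's projector
contains all `P_{x,z}`, whose span is `Mat_n` by `PauliBasis`). -/
def PauliIrreducible : Prop :=
  ∀ (p k : ℕ) [Fact p.Prime]
    (P : (Fin k → ZMod p) → (Fin k → ZMod p) → Matrix (Fin k → ZMod p) (Fin k → ZMod p) ℂ),
    IsPauliFamily p k P →
      ∀ W : Submodule ℂ ((Fin k → ZMod p) → ℂ),
        (∀ x z, ∀ v ∈ W, (P x z).mulVec v ∈ W) → (W = ⊥ ∨ W = ⊤)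

/-- Quantifier shape of the line's pay-off (both cards): a certificate predicate `Cert p k r`
("the tripartite index class / the parity summand exists at (p,k,r)") that is MONOTONE-FREE in r
and implies `r < bR(⟨p^k,p^k,p^k⟩)`; the crux follows from certificates at `r = ⌊p^{(2+δ)k}⌋`
for all large `k`.  This is just the glue, recorded so that crux-plan can type the stubs. -/
theorem smithPhaseGap_of_certificates
    (Cert : ℕ → ℕ → ℕ → Prop)
    (sound : ∀ p k r, Cert p k r →
      r < Literature.Computability.AlgebraicComplexity.algBorderRank
            (Literature.Computability.AlgebraicComplexity.matMulTensor ℂ (p ^ k) (p ^ k) (p ^ k)))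
    (supply : ∃ p : ℕ, p.Prime ∧ ∃ δ : ℝ, 0 < δ ∧ ∃ k₀ : ℕ, ∀ k : ℕ, k₀ ≤ k →
      ∃ r : ℕ, ((p ^ k : ℕ) : ℝ) ^ (2 + δ) < (r : ℝ) + 1 ∧ Cert p k r) :
    -- literally the body of `…Theses.PauliSmithLocalisation.SmithPhaseGap` (route module not
    -- imported here so that this workfile elaborates against Literature only; Sketch.lean in the
    -- ideator folder proves the same statement with the route decl as conclusion, rc 0):
    (∃ p : ℕ, p.Prime ∧ ∃ δ : ℝ, 0 < δ ∧ ∃ k₀ : ℕ, ∀ k : ℕ, k₀ ≤ k → ((p ^ k : ℕ) : ℝ) ^ (2 + δ) <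
      (Literature.Computability.AlgebraicComplexity.algBorderRank
        (Literature.Computability.AlgebraicComplexity.matMulTensor ℂ (p ^ k) (p ^ k) (p ^ k)) : ℝ)) := by
  obtain ⟨p, hp, δ, hδ, k₀, h⟩ := supply
  refine ⟨p, hp, δ, hδ, k₀, fun k hk => ?_⟩
  obtain ⟨r, hr, hc⟩ := h k hk
  have h1 := sound p k r hc
  have h2 : ((r : ℝ) + 1) ≤ (Literature.Computability.AlgebraicComplexity.algBorderRank
            (Literature.Computability.AlgebraicComplexity.matMulTensor ℂ (p ^ k) (p ^ k) (p ^ k)) : ℝ) := by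
    exact_mod_cast h1
  exact lt_of_lt_of_le hr h2

end Summit.MatrixMultiplication.MatrixMultiplication.Cruxes.SmithPhaseGap.Ideator1
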